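import Literature.NumberTheory.ComplexMultiplication.FiniteQAlgebraLatticePowersInvertible
import HarnessLib

/-!
# THE BOUND `n − 1` OF HL 2026 THEOREM 10.1 ∕ DTZ62 THEOREM C IS SHARP IN EVERY finite-dimensional commutative
# `ℚ`-algebra `A` containing a monogenic order: Dedekind's lattice `L = ⟨1, a, 2a², …, 2a^{n−1}⟩_ℤ` in
# `ℤ[a] = ⊕_{j<n} ℤa^j` has `L ⊊ L² ⊊ ⋯ ⊊ L^{n−1} = L^n = ⋯ = ℤ[a]`, and `L, L², …, L^{n−2}` are not invertible
# (Hertling–Larabi 2026b Example 4.7 = [DTZ62], ascribed to Dedekind) — nilpotents allowed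

[topic NumberTheory/ComplexMultiplication] General-`A` series (namespace
`Literature.NumberTheory.ComplexMultiplication.FiniteQAlgebraLattice`), the general-`A` twin of the `Y = L_1 ⊕ ⋯ ⊕ L_t`
file `CMAlgebraLatticePowersInvertibleSharp` (seat p19 gen 34, row g34-#3), whose proofs use nothing of `Y` beyond
its commutative `ℚ`-algebra structure; HL26b state Example 4.7 for an ARBITRARY `A` («Let `dim A = n ≥ 3` and
suppose that `Λ = ℤ[a] ⊂ A` is an order»), e.g. `A = ℚ[x]/(xⁿ)`, `a = x̄`, which the `Y`-file does not cover.
Companion of `FiniteQAlgebraLatticePowersInvertible` (HL 2026 THEOREM 10.1 for general `A`: `M^k` is invertible for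
every full lattice `M` and every `k ≥ n − 1`, `pow_mul_div_div_eq_of_isFullLattice`; and HL26b LEMMA 4.6 for general
`A`: the powers below the stationary one are not invertible, `pow_mul_div_div_ne_of_ne_pow` — REUSED by name).
Lane `lit-hodgefound` (Track 2 foundations library), seat p19 generation 37, row g37-#2.  THEOREMS ONLY: no
definition, no instance, no notation, no named fact (D-0026, net Literature debt `0`), no `sorry`.

## Source, VERBATIM

C. Hertling, K. Larabi, *Conjugacy classes of regular integer matrices*, arXiv:2602.15748 (2026)
[HertlingLarabi2026b], held `paper:arxiv-2602.15748`, §4 chunk p0007 — throughout «`A` is a finite dimensional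
commutative ℚ-algebra with unit element `1_A`» (§3), not assumed separable: «**Lemma 4.6.** Let `Λ` be an order,
and let `L` be a full lattice which is not an order, but which satisfies `1_A ∈ L` and `L ⊂ Λ`. Then there is a
unique `l ∈ ℤ_{≥2}` with `L ⊊ L² ⊊ ⋯ ⊊ L^l = L^{l+k} ⊂ Λ` for `k ≥ 1`. `L^l` is an order with `L·L^l = L^l`. The full
lattices `L, L², …, L^{l−1}` are not invertible. […] [DTZ62] gives the example 4.7 and ascribes the example and the
observation to Dedekind [De72]. **Example 4.7** (DTZ62). Let `dim A = n ≥ 3` and suppose that `Λ = ℤ[a] ⊂ A` is an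
order. Define `L := ⟨1, a, 2a², ..., 2a^{n−1}⟩_ℤ ⊂ Λ`. Then `L² = ⟨1_A, a, a², 2a³, ..., 2a^{n−1}⟩_ℤ`,
`L³ = ⟨1_A, a, a², a³, 2a⁴, ..., 2a^{n−1}⟩_ℤ`, ⋯, `L^{n−1} = ⟨1_A, a, a², ..., a^{n−1}⟩_ℤ = Λ`,
`L ⊊ L² ⊊ L³ ⊊ ... ⊊ L^{n−1} = L^n = ... = Λ`, and `L, L², ..., L^{n−2}` are not invertible by Lemma 4.6.»
([HertlingLarabi2026] §10, chunk p0026, on the same example, after Theorem 10.1 «`L^k` is invertible if `k ≥ n − 1`».)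

## What is proved

For a commutative `ℚ`-algebra `A`, `n ≥ 2` resp. `n = finrank ℚ A ≥ 3`, an element `a ∈ A` such that
`Λ := ⟨1, a, …, a^{n−1}⟩_ℤ` is closed under multiplication (resp. also a full lattice — HL's «suppose that
`Λ = ℤ[a] ⊂ A` is an order»), and the lattices `M_k := ⟨c_{k,j}a^j : j < n⟩_ℤ`, `c_{k,j} = 1` for `j ≤ k`, `= 2` for
`j > k` (so `L = M_1`, `M_k = Λ` for `k ≥ n − 1`), all written as `Submodule.span ℤ (Set.range …)`:
* §1–§2 (any commutative ring, any `n ≥ 2`): `span_smulPow_mul_span_smulPow_one` — `M_k·M_1 = M_{k+1}` (`k ≥ 1`),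
  hence `pow_span_smulPow_one_eq` — `L^k = M_k` for `k ≥ 1` (the displayed list of powers),
  `pow_span_smulPow_one_eq_span_pow` — `L^k = Λ` for `k ≥ n − 1`;
* §3 (`n = finrank ℚ A`, `Λ` full): `linearIndependent_pow_of_isFullLattice`, `pow_succ_not_mem_span_smulPow` —
  `a^{k+1} ∉ M_k` for `k + 1 < n`, so `L ⊊ L² ⊊ ⋯ ⊊ L^{n−1}` (`pow_span_smulPow_one_ne_pow_succ`);
* **`pow_span_smulPow_one_mul_div_div_ne` — `L^j` is NOT invertible for `1 ≤ j ≤ n − 2`** (by the general-`A`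
  Lemma 4.6 `pow_mul_div_div_ne_of_ne_pow`), while `L^{n−1} = Λ` is (an order); packaged with Theorem 10.1's bound
  as **`exists_isFullLattice_pow_not_invertible`: the exponent `n − 1` of HL 2026 Thm. 10.1 ∕ DTZ62 Theorem C
  cannot be lowered** whenever `A` contains such an `a`.
NOT here: the existence of a monogenic order `ℤ[a]` in a given `A` (for cyclic `A = ℚ[a₀]` some `ℤ[ka₀]`, HL26b
Lemma 4.11 (a)(ii), `FiniteQAlgebraLatticeMetricDual.exists_isFullLattice_adjoin_zsmul`).

## References
* [HertlingLarabi2026b] C. Hertling, K. Larabi, *Conjugacy classes of regular integer matrices*, arXiv:2602.15748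
  (2026), §4 Lemma 4.6, Example 4.7 (chunk p0007). [cite: HertlingLarabi2026b, §4 Example 4.7 and Lemma 4.6, chunk p0007]
* [HertlingLarabi2026] C. Hertling, K. Larabi, *Semigroups from full lattices in commutative ℚ-algebras*,
  arXiv:2602.14973 (2026), §10 Thm. 10.1 and the Dedekind example (chunk p0026). [cite: HertlingLarabi2026, §10 Thm. 10.1, chunk p0026]
* [DadeTausskyZassenhaus1962] E. C. Dade, O. Taussky, H. Zassenhaus, Math. Ann. 148 (1962) 31–64 (the example, ascribed
  to Dedekind; as cited by HL26b Example 4.7; not held). [cite: DadeTausskyZassenhaus1962, §1.5 (example after Theorem C, as cited by HL26 Ex. 4.7)]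
-/

noncomputable section

open scoped Pointwise
open Module Function Submodule

namespace Literature.NumberTheory.ComplexMultiplication.FiniteQAlgebraLattice

open Literature.NumberTheory.Automorphic

section DedekindExample

variable {A : Type} [CommRing A] [Algebra ℚ A]

/-! ## §1 The lattices `M_k = ⟨c_{k,j}a^j⟩`, `c_{k,j} ∈ {1, 2}` -/

omit [Algebra ℚ A] in
/-- `M_k ⊆ M_{k'}` for `k ≤ k'` (coefficient conditions weaken). [cite: HertlingLarabi2026b, §4 Example 4.7, chunk p0007] -/
theorem span_smulPow_mono (a : A) {n k k' : ℕ} (hkk' : k ≤ k') :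
    span ℤ (Set.range fun j : Fin n => (if (j : ℕ) ≤ k then (1 : ℤ) else 2) • a ^ (j : ℕ)) ≤
      span ℤ (Set.range fun j : Fin n => (if (j : ℕ) ≤ k' then (1 : ℤ) else 2) • a ^ (j : ℕ)) := by
  rw [span_le]
  rintro _ ⟨j, rfl⟩
  by_cases hj : (j : ℕ) ≤ k
  · have hj' : (j : ℕ) ≤ k' := hj.trans hkk'
    simp only [hj, if_true]
    exact subset_span ⟨j, by simp only [hj', if_true]⟩
  · by_cases hj' : (j : ℕ) ≤ k'
    · simp only [hj, if_false]
      have h := subset_span (R := ℤ) (s := Set.range fun j : Fin n => (if (j : ℕ) ≤ k' then (1 : ℤ) else 2) • a ^ (j : ℕ))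
        ⟨j, rfl⟩
      simp only [hj', if_true, one_smul] at h
      exact smul_mem _ _ h
    · simp only [hj, if_false]
      exact subset_span ⟨j, by simp only [hj', if_false]⟩

omit [Algebra ℚ A] in
/-- `2a^j ∈ M_k` for every `j < n`. [cite: HertlingLarabi2026b, §4 Example 4.7, chunk p0007] -/
theorem two_smul_pow_mem_span_smulPow (a : A) {n : ℕ} (k : ℕ) (j : Fin n) :
    (2 : ℤ) • a ^ (j : ℕ) ∈ span ℤ (Set.range fun j : Fin n => (if (j : ℕ) ≤ k then (1 : ℤ) else 2) • a ^ (j : ℕ)) := by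
  by_cases hj : (j : ℕ) ≤ k
  · have h := subset_span (R := ℤ) (s := Set.range fun j : Fin n => (if (j : ℕ) ≤ k then (1 : ℤ) else 2) • a ^ (j : ℕ))
      ⟨j, rfl⟩
    simp only [hj, if_true, one_smul] at h
    exact smul_mem _ _ h
  · exact subset_span ⟨j, by simp only [hj, if_false]⟩

omit [Algebra ℚ A] in
/-- `M_k ⊆ Λ = ⟨a^j⟩`. [cite: HertlingLarabi2026b, §4 Example 4.7 («`⊂ Λ`»), chunk p0007] -/
theorem span_smulPow_le_span_pow (a : A) {n : ℕ} (k : ℕ) :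
    span ℤ (Set.range fun j : Fin n => (if (j : ℕ) ≤ k then (1 : ℤ) else 2) • a ^ (j : ℕ)) ≤
      span ℤ (Set.range fun j : Fin n => a ^ (j : ℕ)) := by
  rw [span_le]
  rintro _ ⟨j, rfl⟩
  exact smul_mem _ _ (subset_span ⟨j, rfl⟩)

omit [Algebra ℚ A] in
/-- For `k ≥ n − 1` all coefficients are `1`: `M_k = Λ`. [cite: HertlingLarabi2026b, §4 Example 4.7 («`L^{n−1} = ⟨1_A, a, …, a^{n−1}⟩_ℤ = Λ`»), chunk p0007] -/
theorem span_smulPow_eq_span_pow (a : A) {n k : ℕ} (hk : n - 1 ≤ k) :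
    span ℤ (Set.range fun j : Fin n => (if (j : ℕ) ≤ k then (1 : ℤ) else 2) • a ^ (j : ℕ)) =
      span ℤ (Set.range fun j : Fin n => a ^ (j : ℕ)) := by
  have hfun : (fun j : Fin n => (if (j : ℕ) ≤ k then (1 : ℤ) else 2) • a ^ (j : ℕ)) = fun j : Fin n => a ^ (j : ℕ) := by
    funext j
    rw [if_pos (by omega), one_smul]
  rw [hfun]

omit [Algebra ℚ A] in
/-- `2Λ ⊆ M_k`. [cite: HertlingLarabi2026b, §4 Example 4.7, chunk p0007] -/
theorem two_smul_mem_span_smulPow (a : A) {n : ℕ} (k : ℕ) {x : A}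
    (hx : x ∈ span ℤ (Set.range fun j : Fin n => a ^ (j : ℕ))) :
    (2 : ℤ) • x ∈ span ℤ (Set.range fun j : Fin n => (if (j : ℕ) ≤ k then (1 : ℤ) else 2) • a ^ (j : ℕ)) := by
  refine span_induction (fun y hy => ?_) (by rw [smul_zero]; exact zero_mem _)
    (fun y z _ _ hy hz => by rw [smul_add]; exact add_mem hy hz)
    (fun m y _ hy => by rw [smul_comm]; exact smul_mem _ _ hy) hx
  obtain ⟨j, rfl⟩ := hy
  exact two_smul_pow_mem_span_smulPow a k j

omit [Algebra ℚ A] in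
/-- In an order `Λ = ⟨1, a, …, a^{n−1}⟩` (`ΛΛ ⊆ Λ`, `n ≥ 2`) all powers of `a` lie in `Λ`. [cite: HertlingLarabi2026b, §4 Example 4.7 («`Λ = ℤ[a]` is an order»), chunk p0007] -/
theorem pow_mem_span_pow (a : A) {n : ℕ} (hn : 2 ≤ n)
    (hmul : span ℤ (Set.range fun j : Fin n => a ^ (j : ℕ)) * span ℤ (Set.range fun j : Fin n => a ^ (j : ℕ)) ≤
      span ℤ (Set.range fun j : Fin n => a ^ (j : ℕ))) (m : ℕ) :
    a ^ m ∈ span ℤ (Set.range fun j : Fin n => a ^ (j : ℕ)) := by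
  induction m with
  | zero => exact subset_span ⟨⟨0, by omega⟩, by simp⟩
  | succ m ih =>
    rw [pow_succ]
    exact hmul (mul_mem_mul ih (subset_span ⟨⟨1, by omega⟩, by simp⟩))


omit [Algebra ℚ A] in
/-- `a^j ∈ M_k` for `j ≤ k`, `j < n`. [cite: HertlingLarabi2026b, §4 Example 4.7, chunk p0007] -/
theorem pow_mem_span_smulPow_of_le (a : A) {n k : ℕ} (j : Fin n) (hj : (j : ℕ) ≤ k) :
    a ^ (j : ℕ) ∈ span ℤ (Set.range fun j : Fin n => (if (j : ℕ) ≤ k then (1 : ℤ) else 2) • a ^ (j : ℕ)) :=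
  subset_span ⟨j, by simp only [hj, if_true, one_smul]⟩

/-! ## §2 The powers of `L = M_1`: `L^k = M_k` -/

omit [Algebra ℚ A] in
/-- **`M_k·M_1 = M_{k+1}`** (`k ≥ 1`, `n ≥ 2`; `2Λ ⊆ M_{k+1}` absorbs every product with an even coefficient, and `a^n ∈ Λ`
only occurs when `M_{k+1} = Λ`). [cite: HertlingLarabi2026b, §4 Example 4.7 (the displayed powers), chunk p0007] -/
theorem span_smulPow_mul_span_smulPow_one (a : A) {n : ℕ} (hn : 2 ≤ n)
    (hmul : span ℤ (Set.range fun j : Fin n => a ^ (j : ℕ)) * span ℤ (Set.range fun j : Fin n => a ^ (j : ℕ)) ≤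
      span ℤ (Set.range fun j : Fin n => a ^ (j : ℕ))) {k : ℕ} (hk : 1 ≤ k) :
    span ℤ (Set.range fun j : Fin n => (if (j : ℕ) ≤ k then (1 : ℤ) else 2) • a ^ (j : ℕ)) *
        span ℤ (Set.range fun j : Fin n => (if (j : ℕ) ≤ 1 then (1 : ℤ) else 2) • a ^ (j : ℕ)) =
      span ℤ (Set.range fun j : Fin n => (if (j : ℕ) ≤ k + 1 then (1 : ℤ) else 2) • a ^ (j : ℕ)) := by
  have hΛ := pow_mem_span_pow a hn hmul
  apply le_antisymm
  · rw [span_mul_span, span_le]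
    rintro _ ⟨_, ⟨i, rfl⟩, _, ⟨j, rfl⟩, rfl⟩
    simp only [SetLike.mem_coe]
    rw [smul_mul_smul_comm, ← pow_add]
    by_cases hi : (i : ℕ) ≤ k
    · by_cases hj1 : (j : ℕ) ≤ 1
      · -- coefficient `1·1`: the power `a^{i+j}` with `i + j ≤ k + 1`
        simp only [hi, hj1, if_true, one_mul, one_smul]
        by_cases hlt : (i : ℕ) + j < n
        · exact pow_mem_span_smulPow_of_le a ⟨(i : ℕ) + j, hlt⟩ (by simp only; omega)
        · rw [span_smulPow_eq_span_pow a (by omega)]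
          exact hΛ _
      · simp only [hi, hj1, if_true, if_false, one_mul]
        exact two_smul_mem_span_smulPow a _ (hΛ _)
    · by_cases hj1 : (j : ℕ) ≤ 1
      · simp only [hi, hj1, if_true, if_false, mul_one]
        exact two_smul_mem_span_smulPow a _ (hΛ _)
      · simp only [hi, hj1, if_false]
        rw [show ((2 : ℤ) * 2) = 2 * 2 from rfl, mul_smul]
        exact smul_mem _ _ (two_smul_mem_span_smulPow a _ (hΛ _))
  · rw [span_le]
    rintro _ ⟨j, rfl⟩
    simp only [SetLike.mem_coe]
    have ha1 : a ∈ span ℤ (Set.range fun j : Fin n => (if (j : ℕ) ≤ 1 then (1 : ℤ) else 2) • a ^ (j : ℕ)) := by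
      have h := pow_mem_span_smulPow_of_le (k := 1) a (⟨1, by omega⟩ : Fin n) le_rfl
      rwa [pow_one] at h
    by_cases hj : (j : ℕ) ≤ k + 1
    · simp only [hj, if_true, one_smul]
      rcases Nat.eq_zero_or_pos (j : ℕ) with h0 | hpos
      · -- `1 = 1·1`
        rw [h0, pow_zero, ← one_mul (1 : A)]
        refine mul_mem_mul ?_ ?_
        · have h := pow_mem_span_smulPow_of_le (k := k) a (⟨0, by omega⟩ : Fin n) (Nat.zero_le _)
          rwa [pow_zero] at h
        · have h := pow_mem_span_smulPow_of_le (k := 1) a (⟨0, by omega⟩ : Fin n) (Nat.zero_le _)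
          rwa [pow_zero] at h
      · -- `a^j = a^{j-1}·a`
        rw [show (j : ℕ) = ((j : ℕ) - 1) + 1 by omega, pow_succ]
        exact mul_mem_mul (pow_mem_span_smulPow_of_le a ⟨(j : ℕ) - 1, by omega⟩ (by simp only; omega)) ha1
    · -- `2a^j = (2a^{j-1})·a`
      simp only [hj, if_false]
      rw [show (j : ℕ) = ((j : ℕ) - 1) + 1 by omega, pow_succ, ← smul_mul_assoc]
      exact mul_mem_mul (two_smul_pow_mem_span_smulPow a k ⟨(j : ℕ) - 1, by omega⟩) ha1

omit [Algebra ℚ A] in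
/-- **THE POWERS OF DEDEKIND'S LATTICE: `L^k = M_k = ⟨1, a, …, a^k, 2a^{k+1}, …, 2a^{n−1}⟩` for `k ≥ 1`**, `L = M_1 =
⟨1, a, 2a², …, 2a^{n−1}⟩`. [cite: HertlingLarabi2026b, §4 Example 4.7, chunk p0007] -/
theorem pow_span_smulPow_one_eq (a : A) {n : ℕ} (hn : 2 ≤ n)
    (hmul : span ℤ (Set.range fun j : Fin n => a ^ (j : ℕ)) * span ℤ (Set.range fun j : Fin n => a ^ (j : ℕ)) ≤
      span ℤ (Set.range fun j : Fin n => a ^ (j : ℕ))) {k : ℕ} (hk : 1 ≤ k) :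
    span ℤ (Set.range fun j : Fin n => (if (j : ℕ) ≤ 1 then (1 : ℤ) else 2) • a ^ (j : ℕ)) ^ k =
      span ℤ (Set.range fun j : Fin n => (if (j : ℕ) ≤ k then (1 : ℤ) else 2) • a ^ (j : ℕ)) := by
  induction k, hk using Nat.le_induction with
  | base => rw [pow_one]
  | succ k hk ih => rw [pow_succ, ih, span_smulPow_mul_span_smulPow_one a hn hmul hk]

omit [Algebra ℚ A] in
/-- **`L^k = Λ = ℤ[a]` for every `k ≥ n − 1`** («`L^{n−1} = L^n = ... = Λ`»). [cite: HertlingLarabi2026b, §4 Example 4.7, chunk p0007] -/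
theorem pow_span_smulPow_one_eq_span_pow (a : A) {n : ℕ} (hn : 2 ≤ n)
    (hmul : span ℤ (Set.range fun j : Fin n => a ^ (j : ℕ)) * span ℤ (Set.range fun j : Fin n => a ^ (j : ℕ)) ≤
      span ℤ (Set.range fun j : Fin n => a ^ (j : ℕ))) {k : ℕ} (hk : n - 1 ≤ k) :
    span ℤ (Set.range fun j : Fin n => (if (j : ℕ) ≤ 1 then (1 : ℤ) else 2) • a ^ (j : ℕ)) ^ k =
      span ℤ (Set.range fun j : Fin n => a ^ (j : ℕ)) := by
  rw [pow_span_smulPow_one_eq a hn hmul (by omega), span_smulPow_eq_span_pow a hk]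

/-! ## §3 Strictness `L ⊊ L² ⊊ ⋯ ⊊ L^{n−1}` and non-invertibility of `L, …, L^{n−2}` -/

/-- The powers `1, a, …, a^{n−1}` spanning a full lattice are `ℤ`-linearly independent (`n = dim_ℚ Y`).
[cite: HertlingLarabi2026, §2 Def. 2.1 (a), Lemma 2.2 (a), chunk p0005] -/
theorem linearIndependent_pow_of_isFullLattice (a : A)
    (hfull : IsFullLattice A (span ℤ (Set.range fun j : Fin (finrank ℚ A) => a ^ (j : ℕ)))) :
    LinearIndependent ℤ (fun j : Fin (finrank ℚ A) => a ^ (j : ℕ)) := by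
  have hQ : LinearIndependent ℚ (fun j : Fin (finrank ℚ A) => a ^ (j : ℕ)) := by
    refine linearIndependent_of_top_le_span_of_card_eq_finrank (fun y _ => ?_) (Fintype.card_fin _)
    obtain ⟨m, hm, hmy⟩ := hfull.2 y
    have hy : y = (m : ℚ)⁻¹ • ((m : ℤ) • y) := by
      rw [← Int.cast_smul_eq_zsmul ℚ, smul_smul, inv_mul_cancel₀ (by exact_mod_cast hm), one_smul]
    rw [hy]
    exact smul_mem _ _ (span_subset_span ℤ ℚ _ hmy)
  exact hQ.restrict_scalars' ℤ

/-- **`a^{k+1} ∉ M_k` for `k + 1 < n`** (its coefficient on the `ℤ`-basis `(a^j)` would be twice an integer): so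
`M_k ⊊ M_{k+1}`, i.e. `L^k ⊊ L^{k+1}` for `1 ≤ k ≤ n − 2`. [cite: HertlingLarabi2026b, §4 Example 4.7 («`L ⊊ L² ⊊ L³ ⊊ ... ⊊ L^{n−1}`»), chunk p0007] -/
theorem pow_succ_not_mem_span_smulPow (a : A)
    (hfull : IsFullLattice A (span ℤ (Set.range fun j : Fin (finrank ℚ A) => a ^ (j : ℕ))))
    {k : ℕ} (hk : k + 1 < finrank ℚ A) :
    a ^ (k + 1) ∉ span ℤ (Set.range fun j : Fin (finrank ℚ A) =>
      (if (j : ℕ) ≤ k then (1 : ℤ) else 2) • a ^ (j : ℕ)) := by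
  intro hmem
  obtain ⟨m, hm⟩ := (mem_span_range_iff_exists_fun ℤ).1 hmem
  have hli := linearIndependent_pow_of_isFullLattice a hfull
  -- compare coefficients of `a^{k+1}`
  set j₀ : Fin (finrank ℚ A) := ⟨k + 1, hk⟩ with hj₀
  have hrel : ∑ j : Fin (finrank ℚ A),
      (m j * (if (j : ℕ) ≤ k then (1 : ℤ) else 2) - if j = j₀ then 1 else 0) • a ^ (j : ℕ) = 0 := by
    calc ∑ j : Fin (finrank ℚ A),
          (m j * (if (j : ℕ) ≤ k then (1 : ℤ) else 2) - if j = j₀ then 1 else 0) • a ^ (j : ℕ)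
        = ∑ j : Fin (finrank ℚ A), (m j * (if (j : ℕ) ≤ k then (1 : ℤ) else 2)) • a ^ (j : ℕ) -
            ∑ j : Fin (finrank ℚ A), (if j = j₀ then (1 : ℤ) else 0) • a ^ (j : ℕ) := by
          simp only [sub_smul, Finset.sum_sub_distrib]
      _ = a ^ (k + 1) - a ^ (k + 1) := by
          congr 1
          · rw [← hm]
            exact Finset.sum_congr rfl fun j _ => mul_smul _ _ _
          · rw [Finset.sum_eq_single j₀ (fun j _ hj => by rw [if_neg hj, zero_smul])
              (fun h => absurd (Finset.mem_univ _) h), if_pos rfl, one_smul]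
      _ = 0 := sub_self _
  have h0 := Fintype.linearIndependent_iff.1 hli _ hrel j₀
  rw [if_pos rfl, hj₀, if_neg (show ¬ (k + 1 ≤ k) from Nat.not_succ_le_self k)] at h0
  omega

/-- **Dedekind's chain is strict: `L^k ≠ L^{k+1}` for `1 ≤ k ≤ n − 2`.** [cite: HertlingLarabi2026b, §4 Example 4.7, chunk p0007] -/
theorem pow_span_smulPow_one_ne_pow_succ (a : A)
    (hfull : IsFullLattice A (span ℤ (Set.range fun j : Fin (finrank ℚ A) => a ^ (j : ℕ))))
    (hmul : span ℤ (Set.range fun j : Fin (finrank ℚ A) => a ^ (j : ℕ)) *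
        span ℤ (Set.range fun j : Fin (finrank ℚ A) => a ^ (j : ℕ)) ≤
      span ℤ (Set.range fun j : Fin (finrank ℚ A) => a ^ (j : ℕ)))
    {k : ℕ} (hk1 : 1 ≤ k) (hk : k + 1 < finrank ℚ A) :
    span ℤ (Set.range fun j : Fin (finrank ℚ A) => (if (j : ℕ) ≤ 1 then (1 : ℤ) else 2) • a ^ (j : ℕ)) ^ k ≠
      span ℤ (Set.range fun j : Fin (finrank ℚ A) => (if (j : ℕ) ≤ 1 then (1 : ℤ) else 2) • a ^ (j : ℕ)) ^ (k + 1) := by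
  rw [pow_span_smulPow_one_eq a (by omega) hmul hk1, pow_span_smulPow_one_eq a (by omega) hmul (by omega)]
  intro h
  exact pow_succ_not_mem_span_smulPow a hfull hk (h.symm ▸ pow_mem_span_smulPow_of_le a ⟨k + 1, hk⟩ le_rfl)

omit [Algebra ℚ A] in
/-- Dedekind's `L` is a full lattice (it contains `2Λ`). [cite: HertlingLarabi2026b, §4 Example 4.7, chunk p0007] -/
theorem isFullLattice_span_smulPow (a : A) {n : ℕ}
    (hfull : IsFullLattice A (span ℤ (Set.range fun j : Fin n => a ^ (j : ℕ)))) (k : ℕ) :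
    IsFullLattice A (span ℤ (Set.range fun j : Fin n => (if (j : ℕ) ≤ k then (1 : ℤ) else 2) • a ^ (j : ℕ))) := by
  refine ⟨fg_span (Set.finite_range _), fun y => ?_⟩
  obtain ⟨m, hm, hmy⟩ := hfull.2 y
  exact ⟨2 * m, mul_ne_zero two_ne_zero hm, by rw [mul_smul]; exact two_smul_mem_span_smulPow a k hmy⟩

/-- **HL26 EXAMPLE 4.7 ∕ [DTZ62] (Dedekind): the powers `L, L², …, L^{n−2}` of `L = ⟨1, a, 2a², …, 2a^{n−1}⟩` are NOT
invertible**, `n = dim_ℚ Y ≥ 3`, `ℤ[a] = ⟨1, a, …, a^{n−1}⟩` a full lattice closed under multiplication («and `L`, `L²`,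
..., `L^{n−2}` are not invertible by Lemma 4.6» — the tree's `pow_mul_div_div_ne_of_ne_pow`).
[cite: HertlingLarabi2026b, §4 Example 4.7 and Lemma 4.6, chunk p0007]
[cite: DadeTausskyZassenhaus1962, §1.5 (example after Theorem C, as cited by HL26 Ex. 4.7)] -/
theorem pow_span_smulPow_one_mul_div_div_ne (a : A)
    (hfull : IsFullLattice A (span ℤ (Set.range fun j : Fin (finrank ℚ A) => a ^ (j : ℕ))))
    (hmul : span ℤ (Set.range fun j : Fin (finrank ℚ A) => a ^ (j : ℕ)) *
        span ℤ (Set.range fun j : Fin (finrank ℚ A) => a ^ (j : ℕ)) ≤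
      span ℤ (Set.range fun j : Fin (finrank ℚ A) => a ^ (j : ℕ)))
    {k : ℕ} (hk1 : 1 ≤ k) (hk : k + 2 ≤ finrank ℚ A) :
    span ℤ (Set.range fun j : Fin (finrank ℚ A) => (if (j : ℕ) ≤ 1 then (1 : ℤ) else 2) • a ^ (j : ℕ)) ^ k *
        ((span ℤ (Set.range fun j : Fin (finrank ℚ A) => (if (j : ℕ) ≤ 1 then (1 : ℤ) else 2) • a ^ (j : ℕ)) ^ k /
            span ℤ (Set.range fun j : Fin (finrank ℚ A) => (if (j : ℕ) ≤ 1 then (1 : ℤ) else 2) • a ^ (j : ℕ)) ^ k) /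
          span ℤ (Set.range fun j : Fin (finrank ℚ A) => (if (j : ℕ) ≤ 1 then (1 : ℤ) else 2) • a ^ (j : ℕ)) ^ k) ≠
      span ℤ (Set.range fun j : Fin (finrank ℚ A) => (if (j : ℕ) ≤ 1 then (1 : ℤ) else 2) • a ^ (j : ℕ)) ^ k /
        span ℤ (Set.range fun j : Fin (finrank ℚ A) => (if (j : ℕ) ≤ 1 then (1 : ℤ) else 2) • a ^ (j : ℕ)) ^ k := by
  set n := finrank ℚ A with hn
  have h1 : (1 : A) ∈
      span ℤ (Set.range fun j : Fin n => (if (j : ℕ) ≤ 1 then (1 : ℤ) else 2) • a ^ (j : ℕ)) := by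
    have h := pow_mem_span_smulPow_of_le (k := 1) a (⟨0, by omega⟩ : Fin n) (Nat.zero_le _)
    rwa [pow_zero] at h
  -- stationary from `N = n - 1` on
  have hstab : ∀ l : ℕ,
      span ℤ (Set.range fun j : Fin n => (if (j : ℕ) ≤ 1 then (1 : ℤ) else 2) • a ^ (j : ℕ)) ^ (n - 1 + l) =
        span ℤ (Set.range fun j : Fin n => (if (j : ℕ) ≤ 1 then (1 : ℤ) else 2) • a ^ (j : ℕ)) ^ (n - 1) := fun l => by
    rw [pow_span_smulPow_one_eq_span_pow a (by omega) hmul le_rfl,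
      pow_span_smulPow_one_eq_span_pow a (by omega) hmul (Nat.le_add_right _ _)]
  refine pow_mul_div_div_ne_of_ne_pow h1 hstab hk1 ?_
  -- `L^k ≠ L^{n-1} = Λ` since `a^{k+1} ∉ L^k = M_k`
  rw [pow_span_smulPow_one_eq a (by omega) hmul hk1, pow_span_smulPow_one_eq_span_pow a (by omega) hmul le_rfl]
  intro h
  have hmem : a ^ (k + 1) ∈ span ℤ (Set.range fun j : Fin n => a ^ (j : ℕ)) := subset_span ⟨⟨k + 1, by omega⟩, rfl⟩
  rw [← h] at hmem
  exact pow_succ_not_mem_span_smulPow a hfull hk hmem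

/-- **THE EXPONENT `n − 1` OF DTZ62 THEOREM C IS SHARP: if `Y` (`n = dim_ℚ Y ≥ 3`) contains a monogenic order
`ℤ[a] = ⟨1, a, …, a^{n−1}⟩_ℤ`, there is a full lattice `L` with `1 ∈ L ⊆ ℤ[a]`, `L^k = ℤ[a]` for all `k ≥ n − 1`, and
`L^k` NOT invertible for every `1 ≤ k ≤ n − 2`** — Dedekind's `L = ⟨1, a, 2a², …, 2a^{n−1}⟩`.
[cite: HertlingLarabi2026b, §4 Example 4.7, chunk p0007] [cite: DadeTausskyZassenhaus1962, §1.5 (example after Theorem C, as cited by HL26 Ex. 4.7)] -/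
theorem exists_isFullLattice_pow_not_invertible (a : A)
    (hfull : IsFullLattice A (span ℤ (Set.range fun j : Fin (finrank ℚ A) => a ^ (j : ℕ))))
    (hmul : span ℤ (Set.range fun j : Fin (finrank ℚ A) => a ^ (j : ℕ)) *
        span ℤ (Set.range fun j : Fin (finrank ℚ A) => a ^ (j : ℕ)) ≤
      span ℤ (Set.range fun j : Fin (finrank ℚ A) => a ^ (j : ℕ)))
    (hn : 3 ≤ finrank ℚ A) :
    ∃ M : Submodule ℤ A, IsFullLattice A M ∧ (1 : A) ∈ M ∧
      M ≤ span ℤ (Set.range fun j : Fin (finrank ℚ A) => a ^ (j : ℕ)) ∧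
      (∀ k : ℕ, finrank ℚ A - 1 ≤ k →
        M ^ k = span ℤ (Set.range fun j : Fin (finrank ℚ A) => a ^ (j : ℕ))) ∧
      (∀ k : ℕ, 1 ≤ k → k + 2 ≤ finrank ℚ A → M ^ k * ((M ^ k / M ^ k) / M ^ k) ≠ M ^ k / M ^ k) ∧
      ∀ k : ℕ, 1 ≤ k → k + 1 < finrank ℚ A → M ^ k ≠ M ^ (k + 1) := by
  refine ⟨span ℤ (Set.range fun j : Fin (finrank ℚ A) => (if (j : ℕ) ≤ 1 then (1 : ℤ) else 2) • a ^ (j : ℕ)),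
    isFullLattice_span_smulPow a hfull 1, ?_, span_smulPow_le_span_pow a 1,
    fun k hk => pow_span_smulPow_one_eq_span_pow a (by omega) hmul hk,
    fun k hk1 hk => pow_span_smulPow_one_mul_div_div_ne a hfull hmul hk1 hk,
    fun k hk1 hk => pow_span_smulPow_one_ne_pow_succ a hfull hmul hk1 hk⟩
  have h := pow_mem_span_smulPow_of_le (k := 1) a (⟨0, by omega⟩ : Fin (finrank ℚ A)) (Nat.zero_le _)
  rwa [pow_zero] at h

end DedekindExample

end Literature.NumberTheory.ComplexMultiplication.FiniteQAlgebraLattice
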